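import Literature.Analysis.FunctionSpaces.TorusCubeFluxLocalisation
import Literature.Analysis.FunctionSpaces.TorusFourierSeries
import HarnessLib

/-!
# The descent ladder of cube cut-offs: rungs, rung energies, rung pieces

Analysis/FunctionSpaces definition file.  Fix `K₀ S Δ : ℕ` (`2Δ ≤ S`).  The DESCENT LADDER is the family of smoothed cube
cut-offs (`TorusCubeCutoffCommutator.cubeSym`) at the heights `H ℓ = K₀ + S − ℓ S`, `ℓ = 0, 1, …` (rung `0` is an auxiliary
top rung; rungs `1, …, J+1` sit at `K₀, K₀ − S, …, K₀ − J S`):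

* `rungHeight`, `rungSym ℓ = cubeSym (H ℓ) Δ`, `ladderSupp` (the common frequency box), `rungProj ℓ u = P_{χ_ℓ} u`
  (`realTrigPoly` with coefficients `χ_ℓ û`), `rungEnergy ℓ u = Σ_k χ_ℓ(k)² ‖û(k)‖²`, `rungTestCoeff` (coefficients of
  `∂ₐ P_{χ_ℓ²} u`);
* nesting (`rungSym_mul_succ`: `χ_ℓ χ_{ℓ+1} = χ_{ℓ+1}` when `S ≥ 2Δ`), monotonicity, plateaux (`rungSym_eq_one_of_cube`);
* `sqrt_sum_rungTestCoeff_le` — the derivative of the rung test field costs the band limit: `‖∂ₐ P_{χ²} u‖ ≤ 2π(H+2Δ) √E`;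
* SPECTRAL GAPS of the pieces of `u − P_{ℓ−1} u = (u − P_0 u) + Σ_{i<ℓ−1} (P_i u − P_{i+1} u)`:
  `mFourierCoeff_rungPiece_eq_zero` (the coefficients of `P_i u − P_{i+1} u` vanish on `freqBall (n S − 2Δ) + cube(H_ℓ + 2Δ)`
  when `i + 1 + n = ℓ`), `mFourierCoeff_topPiece_eq_zero` (those of `u − P_0 u` vanish on `freqBall (ℓ S − 2Δ) + cube(H_ℓ + 2Δ)`);
* energies of the pieces: `integral_norm_sq_rungPiece_le` (`≤ E_i`), `integral_norm_sq_sub_rungProj_zero_le` (`≤ ‖u‖₂²`).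

These feed the fixed-time rung flux bound `TorusCubeDescentRungFlux.abs_rungFlux_le` (DiPerna–Lions 1989 §II.1 commutator
lemma, organised as a frequency ladder).  Consumer: cell `ad-ideate`, K1L_D `stmt-AnomalousDissipation-27980`,
`stub_effectiveFrameEnergyL_bandKill` (F-k3l-7).
## Mathlib / tree search
Tree: `TorusCubeCutoffCommutator` (`cubeSym`, `cubeSupp`), `TorusCubeFluxLocalisation`, `Torus.realTrigPoly` API
(`mFourierCoeff_realTrigPoly`, `integral_norm_sq_realTrigPoly`, `realTrigPoly_sub`), `Torus.freqBall`,
`Torus.mFourierCoeff_complexify_sub_const_smul`, `Torus.hasSum_sq_norm_mFourierCoeff_complexify`.  No Mathlib notion of a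
dyadic/arithmetic frequency ladder on `UnitAddTorus` exists (`rg "cubeSym|rung" Mathlib` empty).
## References
* R. J. DiPerna, P.-L. Lions, Invent. Math. 98 (1989), §II.1 Lemma II.1. [`DiPernaLions1989`]
* L. Grafakos, *Classical Fourier Analysis* (3rd ed., 2014), §3.1.3, Prop. 3.2.5, Prop. 3.2.7. [`Grafakos2014`] -/

noncomputable section

open MeasureTheory Set Filter Complex UnitAddTorus Function Finset
open scoped ENNReal InnerProductSpace ComplexConjugate

namespace Literature.Analysis.FunctionSpaces
namespace Torus

variable {d : Type*} [Fintype d] [DecidableEq d]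

/-! ## §12 The descent ladder: rungs, nesting, pieces and their spectral gaps -/

section Rung

open EuclideanSpace

variable (K₀ S Δ : ℕ)

/-- The height of rung `ℓ` of the descent ladder: `H ℓ = K₀ + S − ℓ S` (rung `0` is the auxiliary top rung at `K₀ + S`,
rungs `1, …, J+1` sit at `K₀, K₀ − S, …, K₀ − J S`). [cite: DiPernaLions1989, §II.1 Lemma II.1] -/
def rungHeight (ℓ : ℕ) : ℕ := K₀ + S - ℓ * S

/-- The cube weight of rung `ℓ`: `rungSym ℓ = cubeSym (H ℓ) Δ`. [cite: DiPernaLions1989, §II.1 Lemma II.1] -/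
def rungSym (ℓ : ℕ) (k : d → ℤ) : ℝ := cubeSym (rungHeight K₀ S ℓ) Δ k

/-- The common frequency box of the ladder: the cube `‖k‖_∞ ≤ K₀ + S + 2Δ`. [cite: DiPernaLions1989, §II.1 Lemma II.1] -/
def ladderSupp (d : Type*) [Fintype d] [DecidableEq d] (K₀ S Δ : ℕ) : Finset (d → ℤ) := cubeSupp d (K₀ + S + 2 * Δ)

variable {K₀ S Δ}

omit [Fintype d] [DecidableEq d] in
/-- Heights decrease by `S`: `H (ℓ+1) + S = H ℓ` while `(ℓ+1) S ≤ K₀ + S`. [cite: DiPernaLions1989, §II.1 Lemma II.1] -/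
theorem rungHeight_succ_add {ℓ : ℕ} (h : (ℓ + 1) * S ≤ K₀ + S) : rungHeight K₀ S (ℓ + 1) + S = rungHeight K₀ S ℓ := by
  unfold rungHeight; rw [Nat.succ_mul] at h ⊢; omega

omit [Fintype d] [DecidableEq d] in
/-- Heights across `n` rungs: `H (i + n) + n S = H i` while `(i+n) S ≤ K₀ + S`. [cite: DiPernaLions1989, §II.1 Lemma II.1] -/
theorem rungHeight_add {i n : ℕ} (h : (i + n) * S ≤ K₀ + S) : rungHeight K₀ S (i + n) + n * S = rungHeight K₀ S i := by
  unfold rungHeight; rw [Nat.add_mul] at h ⊢; omega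

omit [Fintype d] [DecidableEq d] in
/-- All heights are at most `K₀ + S`. [cite: DiPernaLions1989, §II.1 Lemma II.1] -/
theorem rungHeight_le (ℓ : ℕ) : rungHeight K₀ S ℓ ≤ K₀ + S := Nat.sub_le _ _

/-- Rung weights vanish off the ladder box. [cite: Grafakos2014, §3.1.3] -/
theorem rungSym_eq_zero_of_not_mem {ℓ : ℕ} {k : d → ℤ} (hk : k ∉ ladderSupp d K₀ S Δ) : rungSym K₀ S Δ ℓ k = 0 := by
  unfold rungSym
  refine cubeSym_eq_zero_of_not_mem fun hk' => hk ?_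
  rw [ladderSupp, mem_cubeSupp] at *
  intro i
  have h1 := hk' i
  have h2 := rungHeight_le (K₀ := K₀) (S := S) ℓ
  push_cast at h1 ⊢
  have : ((rungHeight K₀ S ℓ : ℕ) : ℤ) ≤ K₀ + S := by exact_mod_cast h2
  linarith

omit [DecidableEq d] in
/-- **Nesting of consecutive rungs**: where the lower rung weight is positive the upper one equals `1`
(`S ≥ 2Δ`): `rungSym (ℓ+1) k ≤ rungSym ℓ k`, and `rungSym ℓ k · rungSym (ℓ+1) k = rungSym (ℓ+1) k`.
[cite: Grafakos2014, §3.1.3] -/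
theorem rungSym_mul_succ {ℓ : ℕ} (hΔ : 0 < Δ) (hS : 2 * Δ ≤ S) (hℓ : (ℓ + 1) * S ≤ K₀ + S) (k : d → ℤ) :
    rungSym K₀ S Δ ℓ k * rungSym K₀ S Δ (ℓ + 1) k = rungSym K₀ S Δ (ℓ + 1) k := by
  by_cases hz : rungSym K₀ S Δ (ℓ + 1) k = 0
  · rw [hz, mul_zero]
  · -- `k` lies in the outer cube of rung `ℓ+1`, hence in the inner cube of rung `ℓ`
    have hin : ∀ i, |k i| ≤ (rungHeight K₀ S ℓ : ℤ) := by
      intro i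
      by_contra hcon
      rw [not_le] at hcon
      apply hz
      unfold rungSym
      refine cubeSym_eq_zero (i := i) ?_
      have := rungHeight_succ_add (K₀ := K₀) (S := S) hℓ
      have h' : ((rungHeight K₀ S (ℓ + 1) : ℕ) : ℤ) + S = rungHeight K₀ S ℓ := by exact_mod_cast this
      have hS' : (2 * Δ : ℤ) ≤ S := by exact_mod_cast hS
      linarith
    unfold rungSym
    rw [cubeSym_eq_one hΔ (fun i => by exact_mod_cast hin i), one_mul]

omit [DecidableEq d] in
/-- Monotonicity of consecutive rung weights: `rungSym (ℓ+1) k ≤ rungSym ℓ k`. [cite: Grafakos2014, §3.1.3] -/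
theorem rungSym_succ_le {ℓ : ℕ} (hΔ : 0 < Δ) (hS : 2 * Δ ≤ S) (hℓ : (ℓ + 1) * S ≤ K₀ + S) (k : d → ℤ) :
    rungSym K₀ S Δ (ℓ + 1) k ≤ rungSym K₀ S Δ ℓ k := by
  have h := rungSym_mul_succ (K₀ := K₀) hΔ hS hℓ k
  have h1 : rungSym K₀ S Δ (ℓ + 1) k ≤ 1 := cubeSym_le_one _ _ _
  have h0 : 0 ≤ rungSym K₀ S Δ ℓ k := cubeSym_nonneg _ _ _
  have h0' : 0 ≤ rungSym K₀ S Δ (ℓ + 1) k := cubeSym_nonneg _ _ _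
  nlinarith

omit [DecidableEq d] in
/-- **The inner cube of rung `i` is a plateau of all higher rungs' differences**: for `k` in the cube `‖k‖_∞ ≤ H (i+1)`
both `rungSym i k = 1` and `rungSym (i+1) k = 1`. [cite: Grafakos2014, §3.1.3] -/
theorem rungSym_eq_one_of_cube {i : ℕ} (hΔ : 0 < Δ) (hi : (i + 1) * S ≤ K₀ + S) {k : d → ℤ}
    (hk : ∀ j, |k j| ≤ (rungHeight K₀ S (i + 1) : ℤ)) :
    rungSym K₀ S Δ i k = 1 ∧ rungSym K₀ S Δ (i + 1) k = 1 := by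
  have h' : ((rungHeight K₀ S (i + 1) : ℕ) : ℤ) + S = rungHeight K₀ S i := by
    exact_mod_cast rungHeight_succ_add (K₀ := K₀) (S := S) hi
  refine ⟨cubeSym_eq_one hΔ fun j => ?_, cubeSym_eq_one hΔ fun j => hk j⟩
  have := hk j
  have hS0 : (0 : ℤ) ≤ S := by positivity
  linarith

end Rung




section RungPieces

open EuclideanSpace

variable {K₀ S Δ : ℕ}

/-- Coordinates of a frequency in the Euclidean ball of radius `Q` are at most `Q` in modulus. [folklore] -/
private theorem abs_apply_le_of_mem_freqBall {Q : ℕ} {y : d → ℤ} (hy : y ∈ freqBall (d := d) Q) (j : d) :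
    |(y j : ℤ)| ≤ Q := by
  have h1 := abs_apply_le_sqrt_freqNormSq y j
  have h2 : Real.sqrt (freqNormSq y) ≤ Q := by
    rw [Real.sqrt_le_left (Nat.cast_nonneg Q)]; exact mem_freqBall.1 hy
  have : |((y j : ℤ) : ℝ)| ≤ Q := h1.trans h2
  exact_mod_cast this

/-- The rung projections: `P_i u = realTrigPoly (ladder box) (rungSym i • 𝓕u)`. [cite: DiPernaLions1989, §II.1 Lemma II.1] -/
def rungProj (K₀ S Δ : ℕ) (i : ℕ) (u : UnitAddTorus d → EuclideanSpace ℝ d) : UnitAddTorus d → EuclideanSpace ℝ d :=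
  realTrigPoly (ladderSupp d K₀ S Δ) fun k => ((rungSym K₀ S Δ i k : ℝ) : ℂ) • mFourierCoeff (EuclideanSpace.complexify ∘ u) k

/-- The rung energies: `E_i(u) = Σ_k ‖rungSym i k • 𝓕u(k)‖² = ‖P_i u‖₂²`. [cite: DiPernaLions1989, §II.1 Lemma II.1] -/
def rungEnergy (K₀ S Δ : ℕ) (i : ℕ) (u : UnitAddTorus d → EuclideanSpace ℝ d) : ℝ :=
  ∑ k ∈ ladderSupp d K₀ S Δ, ‖((rungSym K₀ S Δ i k : ℝ) : ℂ) • mFourierCoeff (EuclideanSpace.complexify ∘ u) k‖ ^ 2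

/-- The coefficients of the derivative test field of rung `ℓ` in direction `a`: `(2πi kₐ) · (rungSym ℓ k)² · 𝓕u(k)`
(`= 𝓕(∂ₐ P_{χ_ℓ²} u)(k)`). [cite: DiPernaLions1989, §II.1 Lemma II.1] -/
def rungTestCoeff (K₀ S Δ : ℕ) (ℓ : ℕ) (u : UnitAddTorus d → EuclideanSpace ℝ d) (a : d) (k : d → ℤ) : EuclideanSpace ℂ d :=
  (2 * Real.pi * Complex.I * (k a)) • ((((rungSym K₀ S Δ ℓ k) ^ 2 : ℝ) : ℂ) • mFourierCoeff (EuclideanSpace.complexify ∘ u) k)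

/-- `0 ≤ rungEnergy`. [cite: Grafakos2014, Prop. 3.2.7 (3)] -/
theorem rungEnergy_nonneg (i : ℕ) (u : UnitAddTorus d → EuclideanSpace ℝ d) : 0 ≤ rungEnergy (d := d) K₀ S Δ i u :=
  Finset.sum_nonneg fun _ _ => sq_nonneg _

/-- The cube of rung `ℓ` lies in the ladder box. [cite: Grafakos2014, §3.1.3] -/
theorem cubeSupp_rung_subset (ℓ : ℕ) : cubeSupp d (rungHeight K₀ S ℓ + 2 * Δ) ⊆ ladderSupp d K₀ S Δ := by
  intro k hk
  rw [mem_cubeSupp] at hk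
  rw [ladderSupp, mem_cubeSupp]
  intro i
  have h1 := hk i
  have h2 : ((rungHeight K₀ S ℓ : ℕ) : ℤ) ≤ K₀ + S := by exact_mod_cast rungHeight_le (K₀ := K₀) (S := S) ℓ
  push_cast at h1 ⊢
  linarith

/-- The ladder box is symmetric. [cite: Grafakos2014, §3.1.3] -/
theorem neg_mem_ladderSupp {k : d → ℤ} (hk : k ∈ ladderSupp d K₀ S Δ) : -k ∈ ladderSupp d K₀ S Δ := neg_mem_cubeSupp hk

/-- The rung energy can be summed over the cube of the rung only. [cite: Grafakos2014, Prop. 3.2.7 (3)] -/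
theorem sum_cubeSupp_rung_eq_rungEnergy (ℓ : ℕ) (u : UnitAddTorus d → EuclideanSpace ℝ d) :
    ∑ k ∈ cubeSupp d (rungHeight K₀ S ℓ + 2 * Δ), ‖((cubeSym (rungHeight K₀ S ℓ) Δ k : ℝ) : ℂ) •
      mFourierCoeff (EuclideanSpace.complexify ∘ u) k‖ ^ 2 = rungEnergy K₀ S Δ ℓ u := by
  rw [rungEnergy, ← Finset.sum_subset (cubeSupp_rung_subset (K₀ := K₀) (S := S) (Δ := Δ) ℓ)]
  · rfl
  · intro k _ hk
    show ‖((rungSym K₀ S Δ ℓ k : ℝ) : ℂ) • mFourierCoeff (EuclideanSpace.complexify ∘ u) k‖ ^ 2 = 0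
    rw [rungSym, cubeSym_eq_zero_of_not_mem hk]; simp

omit [DecidableEq d] in
/-- The rung test coefficients are conjugate symmetric (for integrable `u`). [cite: Grafakos2014, Prop. 3.2.5] -/
theorem isConjSymm_rungTestCoeff {u : UnitAddTorus d → EuclideanSpace ℝ d} (hu : Integrable u volume) (ℓ : ℕ) (a : d) :
    IsConjSymm (rungTestCoeff K₀ S Δ ℓ u a) :=
  ((isConjSymm_mFourierCoeff hu).real_weight (fun k => by rw [rungSym, rungSym, cubeSym_neg])).deriv a

/-- **Norm of the derivative test field of rung `ℓ`**: `‖∂ₐ P_{χ_ℓ²} u‖₂ ≤ 2π (H_ℓ + 2Δ) √E_ℓ`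
(band limit `|kₐ| ≤ H_ℓ + 2Δ`, `χ² ≤ χ`). [cite: Grafakos2014, Prop. 3.2.7 (3)] -/
theorem sqrt_sum_rungTestCoeff_le (ℓ : ℕ) (u : UnitAddTorus d → EuclideanSpace ℝ d) (a : d) :
    Real.sqrt (∑ k ∈ cubeSupp d (rungHeight K₀ S ℓ + 2 * Δ), ‖rungTestCoeff K₀ S Δ ℓ u a k‖ ^ 2) ≤
      2 * Real.pi * (rungHeight K₀ S ℓ + 2 * Δ) * Real.sqrt (rungEnergy K₀ S Δ ℓ u) := by
  set H : ℕ := rungHeight K₀ S ℓ with hH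
  rw [← sum_cubeSupp_rung_eq_rungEnergy, ← Real.sqrt_sq (show (0:ℝ) ≤ 2 * Real.pi * (H + 2 * Δ) by positivity),
    ← Real.sqrt_mul (sq_nonneg _), Finset.mul_sum]
  refine Real.sqrt_le_sqrt (Finset.sum_le_sum fun k hk => ?_)
  rw [← mul_pow]
  refine pow_le_pow_left₀ (norm_nonneg _) ?_ 2
  rw [rungTestCoeff, rungSym, ← hH, norm_smul, norm_smul, norm_smul]
  have hka : |(k a : ℝ)| ≤ H + 2 * Δ := by exact_mod_cast (mem_cubeSupp.1 hk) a
  have hn : ‖(2 * Real.pi * Complex.I * (k a) : ℂ)‖ = 2 * Real.pi * |(k a : ℝ)| := by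
    rw [norm_mul, norm_mul, norm_mul, Complex.norm_I, mul_one, Complex.norm_intCast, Complex.norm_real, Real.norm_eq_abs,
      Complex.norm_ofNat, abs_of_pos Real.pi_pos]
  rw [hn]
  have hc1 : ‖(((cubeSym H Δ k) ^ 2 : ℝ) : ℂ)‖ ≤ ‖((cubeSym H Δ k : ℝ) : ℂ)‖ := by
    rw [Complex.norm_real, Complex.norm_real, Real.norm_eq_abs, Real.norm_eq_abs, abs_of_nonneg (sq_nonneg _),
      abs_of_nonneg (cubeSym_nonneg _ _ _), sq]
    exact mul_le_of_le_one_left (cubeSym_nonneg _ _ _) (cubeSym_le_one _ _ _)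
  have h1 : 2 * Real.pi * |(k a : ℝ)| ≤ 2 * Real.pi * (H + 2 * Δ) := by nlinarith [Real.pi_pos, abs_nonneg (k a : ℝ)]
  exact mul_le_mul h1 (mul_le_mul_of_nonneg_right hc1 (norm_nonneg _)) (by positivity) (by positivity)

/-- **A rung piece does not see the band-limited part of the drift**: for `i + 1 + n = ℓ`, `n ≥ 1`, the coefficients of
`P_i u − P_{i+1} u` vanish on `ball(nS − 2Δ) + cube(H_ℓ + 2Δ)` (that sum set lies in the plateau cube of rung `i+1`).
[cite: Grafakos2014, §3.1.3] -/
theorem mFourierCoeff_rungPiece_eq_zero (hΔ : 0 < Δ) (hS : 2 * Δ ≤ S) {i n ℓ : ℕ} (hn : 1 ≤ n) (hinℓ : i + 1 + n = ℓ)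
    (hℓ : ℓ * S ≤ K₀ + S) {u : UnitAddTorus d → EuclideanSpace ℝ d} (hu : Integrable u volume)
    {y k : d → ℤ} (hy : y ∈ freqBall (d := d) (n * S - 2 * Δ)) (hk : k ∈ cubeSupp d (rungHeight K₀ S ℓ + 2 * Δ)) :
    mFourierCoeff (EuclideanSpace.complexify ∘ (rungProj K₀ S Δ i u - rungProj K₀ S Δ (i + 1) u)) (y + k) = 0 := by
  have hv : rungProj K₀ S Δ i u - rungProj K₀ S Δ (i + 1) u = realTrigPoly (ladderSupp d K₀ S Δ)
      (fun m => (((rungSym K₀ S Δ i m - rungSym K₀ S Δ (i + 1) m : ℝ)) : ℂ) • mFourierCoeff (EuclideanSpace.complexify ∘ u) m) := by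
    rw [rungProj, rungProj, ← realTrigPoly_sub]
    congr 1; funext m; rw [Pi.sub_apply, Complex.ofReal_sub, sub_smul]
  have hvc : IsConjSymm (fun m => (((rungSym K₀ S Δ i m - rungSym K₀ S Δ (i + 1) m : ℝ)) : ℂ) •
      mFourierCoeff (EuclideanSpace.complexify ∘ u) m) :=
    (isConjSymm_mFourierCoeff hu).real_weight fun m => by simp only [rungSym, cubeSym_neg]
  have hLsym : ∀ m ∈ ladderSupp d K₀ S Δ, -m ∈ ladderSupp d K₀ S Δ := fun m hm => neg_mem_ladderSupp hm
  rw [hv, mFourierCoeff_realTrigPoly hLsym hvc]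
  split_ifs with hm
  · have hcube : ∀ j, |(y + k) j| ≤ (rungHeight K₀ S (i + 1) : ℤ) := by
      intro j
      have h1 := abs_apply_le_of_mem_freqBall hy j
      have h2 := (mem_cubeSupp.1 hk) j
      have h3 : ((rungHeight K₀ S (i + 1) : ℕ) : ℤ) = rungHeight K₀ S ℓ + n * S := by
        have := rungHeight_add (K₀ := K₀) (S := S) (i := i + 1) (n := n) (by rw [hinℓ]; exact hℓ)
        rw [hinℓ] at this; exact_mod_cast this.symm
      have h2Δ : 2 * Δ ≤ n * S := le_trans hS (Nat.le_mul_of_pos_left S hn)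
      have hnS : ((n * S - 2 * Δ : ℕ) : ℤ) = (n * S : ℕ) - 2 * Δ := by push_cast [Nat.cast_sub h2Δ]; ring
      rw [Pi.add_apply, h3]
      rw [hnS] at h1
      push_cast at h1 h2 ⊢
      have := abs_add_le (y j) (k j)
      linarith
    have hi1 : (i + 1) * S ≤ K₀ + S := le_trans (Nat.mul_le_mul_right _ (by omega)) hℓ
    obtain ⟨e1, e2⟩ := rungSym_eq_one_of_cube (K₀ := K₀) (Δ := Δ) hΔ hi1 hcube
    rw [e1, e2]; simp
  · rfl

/-- **The top piece does not see the band-limited part of the drift**: for `ℓ ≥ 1`, the coefficients of `u − P_0 u` vanish on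
`ball(ℓS − 2Δ) + cube(H_ℓ + 2Δ)` (inside the plateau cube `‖k‖_∞ ≤ K₀ + S` of the auxiliary rung). [cite: Grafakos2014, §3.1.3] -/
theorem mFourierCoeff_topPiece_eq_zero (hΔ : 0 < Δ) (hS : 2 * Δ ≤ S) {ℓ : ℕ} (hℓ1 : 1 ≤ ℓ) (hℓ : ℓ * S ≤ K₀ + S)
    {u : UnitAddTorus d → EuclideanSpace ℝ d} (hu : Integrable u volume)
    {y k : d → ℤ} (hy : y ∈ freqBall (d := d) (ℓ * S - 2 * Δ)) (hk : k ∈ cubeSupp d (rungHeight K₀ S ℓ + 2 * Δ)) :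
    mFourierCoeff (EuclideanSpace.complexify ∘ (u - rungProj K₀ S Δ 0 u)) (y + k) = 0 := by
  have hcube : ∀ j, |(y + k) j| ≤ (K₀ : ℤ) + S := by
    intro j
    have h1 := abs_apply_le_of_mem_freqBall hy j
    have h2 := (mem_cubeSupp.1 hk) j
    have h3 : ((rungHeight K₀ S ℓ : ℕ) : ℤ) + ℓ * S = K₀ + S := by
      have := rungHeight_add (K₀ := K₀) (S := S) (i := 0) (n := ℓ) (by rw [zero_add]; exact hℓ)
      rw [zero_add] at this
      have e : rungHeight K₀ S 0 = K₀ + S := by simp [rungHeight]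
      rw [e] at this; exact_mod_cast this
    have h2Δ : 2 * Δ ≤ ℓ * S := le_trans hS (Nat.le_mul_of_pos_left S hℓ1)
    have hnS : ((ℓ * S - 2 * Δ : ℕ) : ℤ) = (ℓ * S : ℕ) - 2 * Δ := by push_cast [Nat.cast_sub h2Δ]; ring
    rw [hnS] at h1
    rw [Pi.add_apply]
    push_cast at h1 h2 h3 ⊢
    have := abs_add_le (y j) (k j)
    linarith
  have hmemF : y + k ∈ ladderSupp d K₀ S Δ := by
    rw [ladderSupp, mem_cubeSupp]; intro j; have := hcube j; push_cast; linarith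
  have e0 : rungSym K₀ S Δ 0 (y + k) = 1 :=
    cubeSym_eq_one hΔ fun j => by have := hcube j; simp [rungHeight]; exact this
  have hP : Integrable (rungProj K₀ S Δ 0 u) volume := (memLp_realTrigPoly _ _ 2).integrable one_le_two
  have hsub : (EuclideanSpace.complexify ∘ (u - rungProj K₀ S Δ 0 u)) =
      (EuclideanSpace.complexify ∘ fun x => u x - (1 : ℝ) • rungProj K₀ S Δ 0 u x) := by
    funext x; simp
  have hLsym : ∀ m ∈ ladderSupp d K₀ S Δ, -m ∈ ladderSupp d K₀ S Δ := fun m hm => neg_mem_ladderSupp hm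
  rw [hsub, mFourierCoeff_complexify_sub_const_smul hu hP, rungProj,
    mFourierCoeff_realTrigPoly hLsym ((isConjSymm_mFourierCoeff hu).real_weight fun m => by simp only [rungSym, cubeSym_neg]),
    if_pos hmemF, e0]
  simp


/-- **Energy of a rung piece**: `‖P_i u − P_{i+1} u‖₂² ≤ E_i(u)` (`0 ≤ χ_i − χ_{i+1} ≤ χ_i`). [cite: Grafakos2014, Prop. 3.2.7 (3)] -/
theorem integral_norm_sq_rungPiece_le (hΔ : 0 < Δ) (hS : 2 * Δ ≤ S) {i : ℕ} (hi : (i + 1) * S ≤ K₀ + S)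
    {u : UnitAddTorus d → EuclideanSpace ℝ d} (hu : Integrable u volume) :
    ∫ x, ‖(rungProj K₀ S Δ i u - rungProj K₀ S Δ (i + 1) u) x‖ ^ 2 ≤ rungEnergy K₀ S Δ i u := by
  have hv : rungProj K₀ S Δ i u - rungProj K₀ S Δ (i + 1) u = realTrigPoly (ladderSupp d K₀ S Δ)
      (fun m => (((rungSym K₀ S Δ i m - rungSym K₀ S Δ (i + 1) m : ℝ)) : ℂ) • mFourierCoeff (EuclideanSpace.complexify ∘ u) m) := by
    rw [rungProj, rungProj, ← realTrigPoly_sub]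
    congr 1; funext m; rw [Pi.sub_apply, Complex.ofReal_sub, sub_smul]
  have hvc : IsConjSymm (fun m => (((rungSym K₀ S Δ i m - rungSym K₀ S Δ (i + 1) m : ℝ)) : ℂ) •
      mFourierCoeff (EuclideanSpace.complexify ∘ u) m) :=
    (isConjSymm_mFourierCoeff hu).real_weight fun m => by simp only [rungSym, cubeSym_neg]
  have hLsym : ∀ m ∈ ladderSupp d K₀ S Δ, -m ∈ ladderSupp d K₀ S Δ := fun m hm => neg_mem_ladderSupp hm
  rw [hv, integral_norm_sq_realTrigPoly hLsym hvc, rungEnergy]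
  refine Finset.sum_le_sum fun k _ => ?_
  rw [norm_smul, norm_smul, Complex.norm_real, Complex.norm_real, Real.norm_eq_abs, Real.norm_eq_abs]
  refine pow_le_pow_left₀ (by positivity) (mul_le_mul_of_nonneg_right ?_ (norm_nonneg _)) 2
  have h1 := rungSym_succ_le (K₀ := K₀) hΔ hS hi k
  have h2 : 0 ≤ rungSym K₀ S Δ (i + 1) k := cubeSym_nonneg _ _ _
  have h3 : 0 ≤ rungSym K₀ S Δ i k := cubeSym_nonneg _ _ _
  rw [abs_of_nonneg (by linarith), abs_of_nonneg h3]
  linarith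

/-- **Energy of the top piece**: `‖u − P_0 u‖₂² ≤ ‖u‖₂²` (its coefficients are `(1 − χ_0) û` with `0 ≤ 1 − χ_0 ≤ 1`).
[cite: Grafakos2014, Prop. 3.2.7 (3)] -/
theorem integral_norm_sq_sub_rungProj_zero_le {u : UnitAddTorus d → EuclideanSpace ℝ d} (hu : MemLp u 2 volume) :
    ∫ x, ‖(u - rungProj K₀ S Δ 0 u) x‖ ^ 2 ≤ ∫ x, ‖u x‖ ^ 2 := by
  have hui : Integrable u volume := hu.integrable one_le_two
  have hP : Integrable (rungProj K₀ S Δ 0 u) volume := (memLp_realTrigPoly _ _ 2).integrable one_le_two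
  have hv : MemLp (u - rungProj K₀ S Δ 0 u) 2 volume := hu.sub (memLp_realTrigPoly _ _ 2)
  have h1 := hasSum_sq_norm_mFourierCoeff_complexify hv
  have h2 := hasSum_sq_norm_mFourierCoeff_complexify hu
  refine hasSum_le (fun k => ?_) h1 h2
  have hLsym : ∀ m ∈ ladderSupp d K₀ S Δ, -m ∈ ladderSupp d K₀ S Δ := fun m hm => neg_mem_ladderSupp hm
  have hsub : (EuclideanSpace.complexify ∘ (u - rungProj K₀ S Δ 0 u)) =
      (EuclideanSpace.complexify ∘ fun x => u x - (1 : ℝ) • rungProj K₀ S Δ 0 u x) := by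
    funext x; simp
  rw [hsub, mFourierCoeff_complexify_sub_const_smul hui hP, rungProj,
    mFourierCoeff_realTrigPoly hLsym ((isConjSymm_mFourierCoeff hui).real_weight fun m => by simp only [rungSym, cubeSym_neg])]
  split_ifs with hk
  · rw [Complex.ofReal_one, one_smul,
      show mFourierCoeff (EuclideanSpace.complexify ∘ u) k - ((rungSym K₀ S Δ 0 k : ℝ) : ℂ) • mFourierCoeff (EuclideanSpace.complexify ∘ u) k
        = ((1 : ℂ) - ((rungSym K₀ S Δ 0 k : ℝ) : ℂ)) • mFourierCoeff (EuclideanSpace.complexify ∘ u) k by rw [sub_smul, one_smul],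
      norm_smul]
    have h0 : 0 ≤ rungSym K₀ S Δ 0 k := cubeSym_nonneg _ _ _
    have h1' : rungSym K₀ S Δ 0 k ≤ 1 := cubeSym_le_one _ _ _
    have : ‖(1 : ℂ) - ((rungSym K₀ S Δ 0 k : ℝ) : ℂ)‖ ≤ 1 := by
      rw [← Complex.ofReal_one, ← Complex.ofReal_sub, Complex.norm_real, Real.norm_eq_abs, abs_of_nonneg (by linarith)]
      linarith
    calc (‖(1 : ℂ) - ((rungSym K₀ S Δ 0 k : ℝ) : ℂ)‖ * ‖mFourierCoeff (EuclideanSpace.complexify ∘ u) k‖) ^ 2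
        ≤ (1 * ‖mFourierCoeff (EuclideanSpace.complexify ∘ u) k‖) ^ 2 :=
          pow_le_pow_left₀ (by positivity) (mul_le_mul_of_nonneg_right this (norm_nonneg _)) 2
      _ = _ := by rw [one_mul]
  · simp

end RungPieces

end Torus
end Literature.Analysis.FunctionSpaces

end
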